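import Literature.Claims.NS.Passolungo2025
import HarnessLib

/-!
# Solo salvage for claim C144 `Passolungo2025` (cell `ns-claims`, D-0090): the referee's charitable
# column — `Step9_Charitable` is TRUE, kernel

Claim skeleton: `Literature/Claims/NS/Passolungo2025.lean` (S. Passolungo, Zenodo 17251544; typist
`ns-claims-typist-6` g5, p523658 + rev 2). This file is the referee's kit (ns-claims-ref-4 g5, REF v1.1
10:55:28Z, `claims/Passolungo2025/RETYPE-ref4g5-step9charitable-proof.lean` sha16 331c40696b190ed5,
204 l.), filed by the salvage lane (seat `ns-claims-salvage-p3` g4) with exactly these edits: namespace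
`RefSketch.Passolungo2025` ↦ this Theorems namespace, this module docblock, `set_option
linter.dupNamespace false`, and `/-- … -/` docstrings added where the kit had none (decl bodies and
statements byte-identical).

Content (ref-4 g5): §13 p.5 l.5 «Integrating and using μ gives ∫₀ᵀ‖S‖_∞ dt < ∞» COMPOSES from the two
printed layer-cake displays (`Step8_LayerCake`) and the Carleson-mass condition (`Step7_CarlesonMass`)
ONCE the unprinted side conditions are supplied: R-a the θ–μ link (`LinkThetaMu`), R-b the low
frequencies `k < J` (`LowFreqBounded`), measurability (`MeasurableGadgets`), and finite constants; the
arithmetic is a geometric series in the dyadic blocks (`step9_charitable : Step9_Charitable`). Read with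
the refutation column `…Theorems.Passolungo2025.not_Step9_Integration` (refuter-2 g6, p525486: the
all-finite gadgets `GW` violate exactly R-a), the kernel pins the non-composition of §13 on the
never-printed relation between `A_{r,θ}` and `μ` (ADJUDICATED #129: class unfilled gap).

Solo lane (`Theorems/SoloSalvage<Slug>….lean`, no item); records-grade, no token effect.

WHAT THIS IS NOT: not a claim about NS regularity or blow-up; not a claim about any author beyond the
typed locator.
-/

set_option linter.dupNamespace false


namespace Summit.NavierStokesRegularity.NavierStokesRegularity.Theorems.Passolungo2025Charitable

open Literature.Claims.NS.Passolungo2025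
open Literature.Claims.NS.PaiLimsuwan2026 (E3 strain)
open Set MeasureTheory Finset
open scoped ENNReal

noncomputable section

/-- R-a: the never-printed link between the level sets `A_{r,θ}` and the Carleson measure `μ`. -/
def LinkThetaMu (G : Gadgets) (T : ℝ) : Prop :=
  ∀ r : ℕ, ∀ a b : ℝ, 0 ≤ a → a ≤ b → b ≤ T →
    (∫⁻ t in Icc a b, ∑' m : ℕ, G.θlev m * (G.A r m).indicator 1 t) ≤ G.μ (Icc a b)

/-- R-b: the low frequencies `k < J` are bounded on `(0,T)`. -/
def LowFreqBounded (G : Gadgets) (T : ℝ) : Prop :=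
  ∃ C₀ : ℝ≥0∞, C₀ ≠ ⊤ ∧ ∀ k < G.J, ∀ t ∈ Ioo 0 T, G.a k t ≤ C₀

/-- R-c: measurability of the shell amplitudes `a_k` and of the level sets `A_{r,m}` (unprinted side
condition; referee's retype, §13 p.5 l.1–5). -/
def MeasurableGadgets (G : Gadgets) : Prop :=
  (∀ k : ℕ, Measurable (G.a k)) ∧ ∀ r m : ℕ, MeasurableSet (G.A r m)

/-- **The referee's charitable face of Step 9** (§13 p.5 l.5; a RETYPE by ns-claims-ref-4 g5, not a
printed statement): with finite constants, `1 ≤ L`, measurable gadgets, bounded low frequencies (R-b) and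
the θ–μ link (R-a), the Carleson mass (Step 7) and the two layer-cake displays (Step 8) give
`∫⁻_{(0,T)} ⨆‖S‖ₑ < ⊤`. -/
def Step9_Charitable : Prop :=
  ∀ (G : Gadgets) (T : ℝ) (u : ℝ → E3 → E3), 0 < T → 1 ≤ G.L → G.Clc ≠ ⊤ → G.Cμ * G.E₀ ≠ ⊤ →
    MeasurableGadgets G → LowFreqBounded G T → LinkThetaMu G T →
    Step7_CarlesonMass G T → Step8_LayerCake G T u → strainSupIntegral T u < ⊤

/-- Regrouping a sum over `range (n*L)` into `n` blocks of length `L`. -/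
theorem sum_range_mul_eq_blocks (g : ℕ → ℝ≥0∞) (L : ℕ) :
    ∀ n : ℕ, ∑ x ∈ range (n * L), g x = ∑ r ∈ range n, ∑ i ∈ range L, g (r * L + i) := by
  intro n
  induction n with
  | zero => simp
  | succ n ih =>
    rw [Nat.succ_mul, Finset.sum_range_add, ih, Finset.sum_range_succ]

/-- A `tsum` over `ℕ` is at most the first `J` terms plus the block sums of length `L ≥ 1`. -/
theorem tsum_le_head_add_blocks (f : ℕ → ℝ≥0∞) (J L : ℕ) (hL : 1 ≤ L) :
    ∑' k, f k ≤ (∑ k ∈ range J, f k) + ∑' r : ℕ, ∑ i ∈ range L, f (J + r * L + i) := by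
  rw [ENNReal.tsum_eq_iSup_nat]
  refine iSup_le fun n => ?_
  have hn : n ≤ J + n * L := by
    have : n ≤ n * L := Nat.le_mul_of_pos_right n hL
    omega
  calc ∑ k ∈ range n, f k ≤ ∑ k ∈ range (J + n * L), f k :=
        Finset.sum_le_sum_of_subset (Finset.range_mono hn)
    _ = (∑ k ∈ range J, f k) + ∑ x ∈ range (n * L), f (J + x) := Finset.sum_range_add f J (n * L)
    _ = (∑ k ∈ range J, f k) + ∑ r ∈ range n, ∑ i ∈ range L, f (J + r * L + i) := by
        rw [sum_range_mul_eq_blocks (fun x => f (J + x)) L n]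
        simp only [add_assoc]
    _ ≤ (∑ k ∈ range J, f k) + ∑' r : ℕ, ∑ i ∈ range L, f (J + r * L + i) :=
        add_le_add le_rfl (ENNReal.sum_le_tsum _)

/-- kit lemma (plumbing) [folklore] -/
theorem two_rpow_split (x : ℝ) :
    (2 : ℝ≥0∞) ^ (-(x / 2)) = (2 : ℝ≥0∞) ^ (-x) * (2 : ℝ≥0∞) ^ (x / 2) := by
  rw [← ENNReal.rpow_add _ _ two_ne_zero (by simp)]
  congr 1; ring

/-- kit lemma (plumbing) [folklore] -/
theorem two_rpow_merge (x : ℝ) :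
    (2 : ℝ≥0∞) ^ (-x) * (2 : ℝ≥0∞) ^ (x / 2) = (2 : ℝ≥0∞) ^ (-(x / 2)) := by
  rw [← ENNReal.rpow_add _ _ two_ne_zero (by simp)]
  congr 1; ring

/-- kit lemma (plumbing) [folklore] -/
theorem two_rpow_neg_ne_top (x : ℝ) : (2 : ℝ≥0∞) ^ (-x) ≠ ⊤ := by
  rw [ENNReal.rpow_neg]
  exact ENNReal.inv_ne_top.2 (ENNReal.rpow_pos two_pos (by simp)).ne'

/-- **`Step9_Charitable` holds** (ref-4 g5): Step 8 (i) + Tonelli; head `k < J` by R-b; dyadic blocks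
`[J + rL, J + (r+1)L)` with `2^{−k/2} ≤ 2^{−(J+rL)} · 2^{k/2}` turning Step 8 (ii) into
`Clc · 2^{−(J+rL)/2} · Σ_m θ_m 1_{A_{r,m}}`; R-a then Step 7 bound each block by `Clc·Cμ·E₀·2^{−(J+rL)/2}`;
geometric series of ratio `2^{−L/2} < 1`. [cite: Passolungo2025, §13 p.5 l.1–5] -/
theorem step9_charitable : Step9_Charitable := by
  intro G T u hT hL hClc hCE hmeas hlow hlink h7 h8
  obtain ⟨C₀, hC₀, hC₀le⟩ := hlow
  obtain ⟨hma, -⟩ := hmeas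
  set f : ℕ → ℝ → ℝ≥0∞ := fun k t => (2 : ℝ≥0∞) ^ (-((k : ℝ) / 2)) * G.a k t with hf
  have hfm : ∀ k, Measurable (f k) := fun k => (hma k).const_mul _
  -- (A) Step8(i) + Tonelli: ∫ sup ≤ Clc · Σ'_k ∫ f k
  have hA : strainSupIntegral T u ≤ G.Clc * ∑' k, ∫⁻ t in Ioo 0 T, f k t := by
    unfold strainSupIntegral
    calc (∫⁻ t in Ioo 0 T, ⨆ x : E3, ‖strain (u t) x‖ₑ)
        ≤ ∫⁻ t in Ioo 0 T, G.Clc * ∑' k, f k t :=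
          setLIntegral_mono' measurableSet_Ioo (fun t ht => h8.1 t (Set.Ioo_subset_Ico_self ht))
      _ = G.Clc * ∫⁻ t in Ioo 0 T, ∑' k, f k t := lintegral_const_mul' _ _ hClc
      _ = G.Clc * ∑' k, ∫⁻ t in Ioo 0 T, f k t := by
          rw [lintegral_tsum (fun k => (hfm k).aemeasurable)]
  -- (B) split the frequency sum: head k < J and dyadic blocks
  have hB : ∑' k, ∫⁻ t in Ioo 0 T, f k t ≤
      (∑ k ∈ range G.J, ∫⁻ t in Ioo 0 T, f k t) +
        ∑' r : ℕ, ∑ i ∈ range G.L, ∫⁻ t in Ioo 0 T, f (G.J + r * G.L + i) t :=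
    tsum_le_head_add_blocks (fun k => ∫⁻ t in Ioo 0 T, f k t) G.J G.L hL
  -- (C) the head: R-b
  have hlowI : ∀ k < G.J, ∫⁻ t in Ioo 0 T, f k t ≤ C₀ * ENNReal.ofReal T := by
    intro k hk
    calc ∫⁻ t in Ioo 0 T, f k t ≤ ∫⁻ _ in Ioo 0 T, C₀ := by
          refine setLIntegral_mono' measurableSet_Ioo (fun t ht => ?_)
          have h2 : (2 : ℝ≥0∞) ^ (-((k : ℝ) / 2)) ≤ 1 := by
            have := ENNReal.rpow_le_rpow_of_exponent_le (x := (2 : ℝ≥0∞)) (by norm_num)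
              (show -((k : ℝ) / 2) ≤ 0 by
                have : (0 : ℝ) ≤ k := Nat.cast_nonneg k
                linarith)
            simpa using this
          calc f k t = (2 : ℝ≥0∞) ^ (-((k : ℝ) / 2)) * G.a k t := rfl
            _ ≤ 1 * C₀ := mul_le_mul' h2 (hC₀le k hk t ht)
            _ = C₀ := one_mul _
      _ = C₀ * volume (Ioo 0 T) := setLIntegral_const _ _
      _ = C₀ * ENNReal.ofReal T := by rw [Real.volume_Ioo, sub_zero]
  have hlowsum : (∑ k ∈ range G.J, ∫⁻ t in Ioo 0 T, f k t) ≤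
      ∑ _k ∈ range G.J, C₀ * ENNReal.ofReal T :=
    Finset.sum_le_sum (fun k hk => hlowI k (Finset.mem_range.1 hk))
  have hlowfin : ∑ _k ∈ range G.J, C₀ * ENNReal.ofReal T < ⊤ :=
    ENNReal.sum_lt_top.2 (fun _ _ => ENNReal.mul_lt_top hC₀.lt_top ENNReal.ofReal_lt_top)
  -- (D) one dyadic block, pointwise on [0,T): Step8(ii)
  have hblock : ∀ r : ℕ, ∀ t ∈ Ico 0 T,
      ∑ i ∈ range G.L, f (G.J + r * G.L + i) t ≤
        G.Clc * (2 : ℝ≥0∞) ^ (-(((G.J : ℝ) + r * G.L) / 2)) *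
          ∑' m : ℕ, G.θlev m * (G.A r m).indicator 1 t := by
    intro r t ht
    have h8ii := h8.2 r t ht
    rw [Finset.sum_Ico_eq_sum_range] at h8ii
    have hlen : G.J + (r + 1) * G.L - (G.J + r * G.L) = G.L := by
      rw [Nat.succ_mul, ← add_assoc, Nat.add_sub_cancel_left]
    rw [hlen] at h8ii
    have hN : ((G.J + r * G.L : ℕ) : ℝ) = (G.J : ℝ) + r * G.L := by push_cast; ring
    calc ∑ i ∈ range G.L, f (G.J + r * G.L + i) t
        ≤ ∑ i ∈ range G.L, (2 : ℝ≥0∞) ^ (-(((G.J : ℝ) + r * G.L))) *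
            ((2 : ℝ≥0∞) ^ (((G.J + r * G.L + i : ℕ) : ℝ) / 2) * G.a (G.J + r * G.L + i) t) := by
          refine Finset.sum_le_sum (fun i _ => ?_)
          have e1 := two_rpow_split (((G.J + r * G.L + i : ℕ) : ℝ))
          have e2 : (2 : ℝ≥0∞) ^ (-(((G.J + r * G.L + i : ℕ) : ℝ))) ≤
              (2 : ℝ≥0∞) ^ (-(((G.J : ℝ) + r * G.L))) := by
            refine ENNReal.rpow_le_rpow_of_exponent_le (by norm_num) ?_
            push_cast
            have : (0 : ℝ) ≤ i := Nat.cast_nonneg i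
            linarith
          show (2 : ℝ≥0∞) ^ (-(((G.J + r * G.L + i : ℕ) : ℝ) / 2)) * G.a (G.J + r * G.L + i) t ≤ _
          rw [e1, mul_assoc]
          exact mul_le_mul_left e2 _
      _ = (2 : ℝ≥0∞) ^ (-(((G.J : ℝ) + r * G.L))) *
            ∑ i ∈ range G.L, (2 : ℝ≥0∞) ^ (((G.J + r * G.L + i : ℕ) : ℝ) / 2) * G.a (G.J + r * G.L + i) t := by
          rw [Finset.mul_sum]
      _ ≤ (2 : ℝ≥0∞) ^ (-(((G.J : ℝ) + r * G.L))) *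
            (G.Clc * (2 : ℝ≥0∞) ^ (((G.J : ℝ) + r * G.L) / 2) *
              ∑' m : ℕ, G.θlev m * (G.A r m).indicator 1 t) := mul_le_mul_right h8ii _
      _ = G.Clc * (2 : ℝ≥0∞) ^ (-(((G.J : ℝ) + r * G.L) / 2)) *
            ∑' m : ℕ, G.θlev m * (G.A r m).indicator 1 t := by
          rw [← two_rpow_merge]; ring
  -- (E) integrate one block: Step8(ii) → R-a → Step7
  have hblockI : ∀ r : ℕ, ∑ i ∈ range G.L, ∫⁻ t in Ioo 0 T, f (G.J + r * G.L + i) t ≤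
      G.Clc * (2 : ℝ≥0∞) ^ (-(((G.J : ℝ) + r * G.L) / 2)) * (G.Cμ * G.E₀) := by
    intro r
    have hc : G.Clc * (2 : ℝ≥0∞) ^ (-(((G.J : ℝ) + r * G.L) / 2)) ≠ ⊤ :=
      ENNReal.mul_ne_top hClc (two_rpow_neg_ne_top _)
    calc ∑ i ∈ range G.L, ∫⁻ t in Ioo 0 T, f (G.J + r * G.L + i) t
        = ∫⁻ t in Ioo 0 T, ∑ i ∈ range G.L, f (G.J + r * G.L + i) t :=
          (lintegral_finsetSum' _ (fun i _ => (hfm _).aemeasurable)).symm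
      _ ≤ ∫⁻ t in Ioo 0 T, G.Clc * (2 : ℝ≥0∞) ^ (-(((G.J : ℝ) + r * G.L) / 2)) *
            ∑' m : ℕ, G.θlev m * (G.A r m).indicator 1 t :=
          setLIntegral_mono' measurableSet_Ioo (fun t ht => hblock r t (Set.Ioo_subset_Ico_self ht))
      _ = G.Clc * (2 : ℝ≥0∞) ^ (-(((G.J : ℝ) + r * G.L) / 2)) *
            ∫⁻ t in Ioo 0 T, ∑' m : ℕ, G.θlev m * (G.A r m).indicator 1 t :=
          lintegral_const_mul' _ _ hc
      _ ≤ G.Clc * (2 : ℝ≥0∞) ^ (-(((G.J : ℝ) + r * G.L) / 2)) *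
            ∫⁻ t in Icc 0 T, ∑' m : ℕ, G.θlev m * (G.A r m).indicator 1 t :=
          mul_le_mul_right (lintegral_mono_set Set.Ioo_subset_Icc_self) _
      _ ≤ G.Clc * (2 : ℝ≥0∞) ^ (-(((G.J : ℝ) + r * G.L) / 2)) * G.μ (Icc 0 T) :=
          mul_le_mul_right (hlink r 0 T le_rfl hT.le le_rfl) _
      _ ≤ G.Clc * (2 : ℝ≥0∞) ^ (-(((G.J : ℝ) + r * G.L) / 2)) * (G.Cμ * G.E₀) :=
          mul_le_mul_right (h7 0 T le_rfl hT.le le_rfl) _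
  -- (F) the geometric series over the blocks
  have hq : (2 : ℝ≥0∞) ^ (-((G.L : ℝ) / 2)) < 1 := by
    refine ENNReal.rpow_lt_one_of_one_lt_of_neg (by norm_num) ?_
    have : (1 : ℝ) ≤ G.L := by exact_mod_cast hL
    linarith
  have hterm : ∀ r : ℕ, (2 : ℝ≥0∞) ^ (-(((G.J : ℝ) + r * G.L) / 2)) ≤
      ((2 : ℝ≥0∞) ^ (-((G.L : ℝ) / 2))) ^ r := by
    intro r
    rw [← ENNReal.rpow_natCast, ← ENNReal.rpow_mul]
    refine ENNReal.rpow_le_rpow_of_exponent_le (by norm_num) ?_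
    have : (0 : ℝ) ≤ G.J := Nat.cast_nonneg _
    nlinarith
  have hgeom : ∑' r : ℕ, (2 : ℝ≥0∞) ^ (-(((G.J : ℝ) + r * G.L) / 2)) < ⊤ := by
    refine lt_of_le_of_lt (ENNReal.tsum_le_tsum hterm) ?_
    rw [ENNReal.tsum_geometric]
    exact (ENNReal.inv_ne_top.2 (tsub_pos_iff_lt.2 hq).ne').lt_top
  have hhighfin : ∑' r : ℕ, G.Clc * (2 : ℝ≥0∞) ^ (-(((G.J : ℝ) + r * G.L) / 2)) * (G.Cμ * G.E₀) < ⊤ := by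
    have hre : ∀ r : ℕ, G.Clc * (2 : ℝ≥0∞) ^ (-(((G.J : ℝ) + r * G.L) / 2)) * (G.Cμ * G.E₀) =
        (G.Clc * (G.Cμ * G.E₀)) * (2 : ℝ≥0∞) ^ (-(((G.J : ℝ) + r * G.L) / 2)) := fun r => by ring
    rw [tsum_congr hre, ENNReal.tsum_mul_left]
    exact ENNReal.mul_lt_top (ENNReal.mul_lt_top hClc.lt_top hCE.lt_top) hgeom
  -- assemble
  calc strainSupIntegral T u ≤ G.Clc * ∑' k, ∫⁻ t in Ioo 0 T, f k t := hA
    _ ≤ G.Clc * ((∑ _k ∈ range G.J, C₀ * ENNReal.ofReal T) +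
          ∑' r : ℕ, G.Clc * (2 : ℝ≥0∞) ^ (-(((G.J : ℝ) + r * G.L) / 2)) * (G.Cμ * G.E₀)) :=
        mul_le_mul_right (hB.trans (add_le_add hlowsum (ENNReal.tsum_le_tsum hblockI))) _
    _ < ⊤ := ENNReal.mul_lt_top hClc.lt_top (ENNReal.add_lt_top.2 ⟨hlowfin, hhighfin⟩)

end

end Summit.NavierStokesRegularity.NavierStokesRegularity.Theorems.Passolungo2025Charitable
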